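import Mathlib
import Summits.KontsevichZagierPeriods.Zeta5Search.Certificates.RayC1Apery
import HarnessLib

/-!
# S4-C1 LITE L6b — clause (E) for the LITERAL C1 pair `(P_n, Q_n) = (c1P n, c1Q n)` (cert-1; port of fam-tele g15's S4-R1 #9)

HONEST FRAMING: systematic search; no irrationality claim unless certified.  C1 = calibration ray (clause (M) only in the tree before
S4-C1; λ* = 108.2193 its certified tie; every γ < 1).  `RayC1Apery.aperyType_c1` gives the Apéry-type recursion for
`(p̂_n, q̂_n) = (P_n, Q_n)/ρ_n`; here the unit `ρ_n = rhoOf (aC1 n)` is put back using `RayC1AperyRho.rho_succ_C1`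
(`ρ_{n+1}·D(n) = −ρ_n·N(n)`: on C1 the sign ALTERNATES, `Σ b_j = 191n`), written as `ρ_{n+1}·D(n) = ρ_n·N⁻(n)` with `N⁻ := −N`, so that
the transport of #9 applies verbatim: `C_k = cPoly k · Π_{j<k} D(X+j) · Π_{k≤j<3} N⁻(X+j)` and
`aperyType_c1PQ : IsAperyType c1P (fun n => (c1Q n : ℚ))`.  An algebraic statement; nothing about `ζ(5)`.
-/

namespace Summit.KontsevichZagierPeriods.Zeta5Search.RayC1.Generic

open Finset Matrix Filter Polynomial
open Summit.KontsevichZagierPeriods.Zeta5Search.WedgeDictionary (rhoOf)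
open Summit.KontsevichZagierPeriods.Zeta5Search.RayC1 (aC1 c1P c1Q NvalC1 DvalC1 NpolyC1 DpolyC1 NpolyC1_eval DpolyC1_eval DvalC1_pos
  DpolyC1_comp_ne rho_succ_C1)
open Summit.KontsevichZagierPeriods.Zeta5Search.RecordRay.Generic (poly_ne_zero_of_eval)
open Literature.NumberTheory.Irrationality.BrownZudilin2022 (IsAperyType)

/-! ### 1. The sign-absorbed numerator ratio `N⁻ = −N` -/

/-- `N⁻(x) := −N(x)`, so that `ρ_{n+1}·D(n) = ρ_n·N⁻(n)` on C1. -/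
def NnegC1 (x : ℚ) : ℚ := -NvalC1 x

/-- `N⁻` as a polynomial. -/
noncomputable def NnegpolyC1 : ℚ[X] := -NpolyC1

/-- `NnegpolyC1` evaluates to `NnegC1`. -/
theorem NnegpolyC1_eval (x : ℚ) : NnegpolyC1.eval x = NnegC1 x := by
  rw [NnegpolyC1, eval_neg, NpolyC1_eval, NnegC1]

/-- `ρ_{n+1}·D(n) = ρ_n·N⁻(n)` (the alternating sign of `rho_succ_C1` absorbed into `N⁻`). -/
theorem rho_succ_C1' (n : ℕ) : rhoOf (aC1 (n + 1)) * DvalC1 (n : ℚ) = rhoOf (aC1 n) * NnegC1 (n : ℚ) := by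
  rw [rho_succ_C1, NnegC1]; ring

/-! ### 2. The recursion for `(P_n, Q_n)` on C1 -/

/-- The coefficients: `C_k = cPoly k · ∏_{j<k} D(X+j) · ∏_{k≤j<3} N(X+j)`. -/
noncomputable def CPoly : Fin 4 → ℚ[X] :=
  ![cPoly 0 * (NnegpolyC1 * NnegpolyC1.comp (X + C 1) * NnegpolyC1.comp (X + C 2)),
    cPoly 1 * (DpolyC1 * NnegpolyC1.comp (X + C 1) * NnegpolyC1.comp (X + C 2)),
    cPoly 2 * (DpolyC1 * DpolyC1.comp (X + C 1) * NnegpolyC1.comp (X + C 2)),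
    cPoly 3 * (DpolyC1 * DpolyC1.comp (X + C 1) * DpolyC1.comp (X + C 2))]

/-- The top coefficient `C_3` of the transported recurrence is a nonzero polynomial. -/
theorem CPoly_three_ne : CPoly 3 ≠ 0 := by
  simp only [CPoly, Fin.isValue, Matrix.cons_val]
  have h0 : DpolyC1 ≠ 0 := poly_ne_zero_of_eval (x := ((0 : ℕ) : ℚ)) (by rw [DpolyC1_eval]; exact (DvalC1_pos 0).ne')
  have h1 := DpolyC1_comp_ne 1
  have h2 := DpolyC1_comp_ne 2
  push_cast at h1 h2
  exact mul_ne_zero cPoly_three_ne (mul_ne_zero (mul_ne_zero h0 h1) h2)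

/-- The transported relation: if `x_m = ρ_m y_m` for `m ∈ {n, …, n+3}` and `Σ_k c_k(n) y_{n+k} = 0`, then
`Σ_k C_k(n) x_{n+k} = 0`. -/
theorem sum_CPoly_eq_zero (n : ℕ) (x y : ℕ → ℚ) (hxy : ∀ k, k ≤ 3 → x (n + k) = rhoOf (aC1 (n + k)) * y (n + k))
    (hy : ∑ k : Fin 4, (cPoly k).eval (n : ℚ) * y (n + k) = 0) :
    ∑ k : Fin 4, (CPoly k).eval (n : ℚ) * x (n + k) = 0 := by
  have R1 : rhoOf (aC1 (n + 1)) * DvalC1 (n : ℚ) = rhoOf (aC1 n) * NnegC1 (n : ℚ) := rho_succ_C1' n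
  have R2 : rhoOf (aC1 (n + 2)) * DvalC1 ((n : ℚ) + 1) = rhoOf (aC1 (n + 1)) * NnegC1 ((n : ℚ) + 1) := by
    have h := rho_succ_C1' (n + 1); push_cast at h; exact h
  have R3 : rhoOf (aC1 (n + 3)) * DvalC1 ((n : ℚ) + 2) = rhoOf (aC1 (n + 2)) * NnegC1 ((n : ℚ) + 2) := by
    have h := rho_succ_C1' (n + 2); push_cast at h; exact h
  have x0 := hxy 0 (by norm_num)
  have x1 := hxy 1 (by norm_num)
  have x2 := hxy 2 (by norm_num)
  have x3 := hxy 3 (by norm_num)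
  simp only [add_zero] at x0
  simp only [Fin.sum_univ_four, Fin.isValue, Fin.val_zero, Fin.val_one, Fin.val_two, add_zero,
    show ((3 : Fin 4) : ℕ) = 3 from rfl] at hy ⊢
  simp only [CPoly, Fin.isValue, Matrix.cons_val_zero, Matrix.cons_val_one, Matrix.cons_val, eval_mul, eval_comp,
    eval_add, eval_X, eval_C, NnegpolyC1_eval, DpolyC1_eval]
  rw [x0, x1, x2, x3]
  linear_combination (rhoOf (aC1 n) * NnegC1 (n : ℚ) * NnegC1 ((n : ℚ) + 1) * NnegC1 ((n : ℚ) + 2)) * hy +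
    ((cPoly 1).eval (n : ℚ) * y (n + 1) * NnegC1 ((n : ℚ) + 1) * NnegC1 ((n : ℚ) + 2)) * R1 +
    ((cPoly 2).eval (n : ℚ) * y (n + 2) * NnegC1 ((n : ℚ) + 2)) * (DvalC1 (n : ℚ) * R2 + NnegC1 ((n : ℚ) + 1) * R1) +
    ((cPoly 3).eval (n : ℚ) * y (n + 3)) *
      (DvalC1 (n : ℚ) * DvalC1 ((n : ℚ) + 1) * R3 + DvalC1 (n : ℚ) * NnegC1 ((n : ℚ) + 2) * R2 +
        NnegC1 ((n : ℚ) + 1) * NnegC1 ((n : ℚ) + 2) * R1)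

/-- **Clause (E) for the literal C1 pair.**  `P_n = c1P n` and `Q_n = c1Q n` (`RayC1Forms`) satisfy one
linear recurrence of order `3` with coefficients in `ℚ[n]` and nonzero top coefficient.  HONEST FRAMING: an algebraic
statement; nothing about `ζ(5)`. -/
theorem aperyType_c1PQ : IsAperyType c1P (fun n => (c1Q n : ℚ)) := by
  refine ⟨3, CPoly, CPoly_three_ne, fun n => ?_, fun n => ?_⟩
  · refine sum_CPoly_eq_zero n c1P pHatC1 (fun k _ => c1P_eq_pHatC1 (n + k)) ?_
    have h := row_rel 0 n
    simp only [pHatC1, mul_neg, Finset.sum_neg_distrib, neg_eq_zero]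
    exact h
  · rcases Nat.eq_zero_or_pos n with rfl | hn
    · simp [CPoly, cPoly, Fin.sum_univ_four]
    · exact sum_CPoly_eq_zero n (fun m => (c1Q m : ℚ)) qHatC1 (fun k _ => c1Q_eq_qHatC1 (n := n + k) (by omega)) (row_rel 2 n)

end Summit.KontsevichZagierPeriods.Zeta5Search.RayC1.Generic
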